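/-
Copyright: the b2b-balaban cell (near-miss cell 7), T⁴-continuum fan-out, NE7b ROUND-2 swarm `t4-ne7b-formalise-*`
(seat leaf-07, gen 2), row S6 pt 3c «zones of realised histories — the binding to leaf-09's pedigrees» (owner's
ruling R-OWNER-22-15) of lineage t4-ne7b-p1's claim table `LEAVES-NE7b.md`.
Released under the licence of the surrounding project.
-/
import Summits.QuantumFields.BalabanUV.T4Continuum.Support.HistoryZonesOrbitPlace
import Summits.QuantumFields.BalabanUV.T4Continuum.Support.HistoryGenBridge

/-!
# History zones from orbits, IV (pt 3c): leaf-09's tagged genealogy CORRESPONDS to its census history, with payloads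

Summits-side support leaf of the T⁴-continuum cell (rung (B)+1 on a FINITE torus only; NOT infinite volume, NOT the
mass gap, NOT the Clay statement; NOT a proof of the spine estimate NE7b).  Row S6 pt 3c (R-OWNER-22-15): the zone
theorems of `HistoryZonesOrbitRealise`∕`…Place` are stated for a tagged genealogy `G` in node-wise correspondence
`Corr sh pay G P` with a realised census history `P`.  The swarm's END reads every live component `c` of a bad term as
leaf-09's TAGGED genealogy `P.genT c : Gen (Lab α π)` (shape map `Prod.fst`, birth tags `Tag.birth c i d x` carrying the
supplier's payload `x : π`) whose census history is leaf-09's bridge `P.toPGen cellP c : PGen (Pt d × Finset (Pt d))`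
(`cellP : π → (anchor, region)`, leaf-08's payload), realised per leaf-08 g2's `RealisedDomains`.  This file proves the
correspondence **`Corr Prod.fst (payOfTag cellP) (P.genT c) (P.toPGen cellP c)`** — leaf-09's `toGen_toPGen` (the FLAT
identity `(toPGen c).toGen = gen c`) replayed node by node WITH the payloads — under the pedigree's encoding fact
`renew_step` (a renewed part comes from the previous step; `RealisedReading.renew_step`).  [folklore] bookkeeping over
leaf-09's carrier; nothing is quoted from print, nothing printed is asserted, no `[cite:]` tag, no `Prop` fact minted.

WHAT.  §1 `payOfTag cellP : Lab α π → Pt d × Finset (Pt d)` (birth tags ↦ `cellP x`, other tags ↦ a junk value);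
`corr_chain` (merger chains ↔ join chains), `corr_partsGenAux` (part genealogies ↔ part histories);
**`corr_genT_toPGen`**.  §2 the END-facing corollaries for ONE realised pending component:
**`birthRegionsD_genT`**, **`admZ_genT_of_realises`**, **`card_admZSet_genT_le_of_realises`** (= `HistoryZonesOrbitPlace`'s
consumers with `G := P.genT c`, `P := P.toPGen cellP c`).  §3 sanity.

HONEST DEPENDENCY (cell): continuum YM on T⁴ ⇐ BetaPertH ∧ nine spine estimates (0/9 proved); BetaPertH ⇐ (D1) ∧ (D4)
∧ CAP+tail; G-an2-4 gates asym, D1 and NE2/3/4.  This file changes none of it.  NE7b NOT proved.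
-/

open Finset
open Literature.MathematicalPhysics.QuantumFieldTheory.Balaban1983to89
open Literature.MathematicalPhysics.QuantumFieldTheory.Balaban1983to89.B13ScaleTransfer
open Literature.MathematicalPhysics.QuantumFieldTheory.Balaban1983to89.B16SProfile
open T4PersistenceDictionary T4PartnerMultiplicity
open Summit.QuantumFields.BalabanUV.T4Continuum.PlacementSkeleton
open Summit.QuantumFields.BalabanUV.T4Continuum.Crowding
open Summit.QuantumFields.BalabanUV.T4Continuum.ZoneSkeleton
open Summit.QuantumFields.BalabanUV.T4Continuum.ZoneCrowd
open Summit.QuantumFields.BalabanUV.T4Continuum.ZoneTorus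
open Summit.QuantumFields.BalabanUV.T4Continuum.HistoryAdmissible
open Summit.QuantumFields.BalabanUV.T4Continuum.HistoryRealise
open Summit.QuantumFields.BalabanUV.T4Continuum.HistoryGen

namespace Summit.QuantumFields.BalabanUV.T4Continuum.HistoryZones

noncomputable section

variable {d : ℕ} {α π : Type*}

/-! ## §1 The correspondence for leaf-09's pedigrees -/

/-- **THE PAYLOAD OF A TAGGED LABEL**: a birth tag `Tag.birth c i d x` carries the supplier's record `x`, read as
`(anchor, region)` through `cellP`; renewal and merger tags carry no region (junk value). [folklore] -/
def payOfTag (cellP : π → Pt d × Finset (Pt d)) : Lab α π → Pt d × Finset (Pt d)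
  | (_, Tag.birth _ _ _ x) => cellP x
  | (_, Tag.ren _ _) => default
  | (_, Tag.mer _ _) => default

variable (cellP : π → Pt d × Finset (Pt d))

/-- a merger chain corresponds to a join chain when the heads and the members correspond and the merger labels have
shape `(s, 2, 0)` [folklore] -/
theorem corr_chain (s : ℕ) :
    ∀ (Gs : List (Gen (Lab α π))) (As : List (PGen (Pt d × Finset (Pt d)))) (G : Gen (Lab α π))
      (A : PGen (Pt d × Finset (Pt d))) (t : ℕ → Lab α π),
      Corr Prod.fst (payOfTag cellP) G A → List.Forall₂ (Corr Prod.fst (payOfTag cellP)) Gs As →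
      (∀ i, (t i).1 = ((s, 2, 0) : PEv)) → Corr Prod.fst (payOfTag cellP) (chainMerge G Gs t) (chainJoin A As s)
  | [], [], G, A, t, hGA, _, _ => hGA
  | H :: Hs, B :: Bs, G, A, t, hGA, hall, ht => by
      obtain ⟨hHB, hrest⟩ := List.forall₂_cons.1 hall
      rw [chainMerge_cons, chainJoin]
      exact corr_chain s Hs Bs _ _ _ ⟨ht 0, hGA, hHB⟩ hrest fun i => ht (i + 1)
  | [], _ :: _, _, _, _, _, hall, _ => by simp at hall
  | _ :: _, [], _, _, _, _, hall, _ => by simp at hall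

/-- the part genealogies of `c` correspond to the part histories, given the correspondence for the old parts and the
encoding fact `renew_step` at `c` [folklore] -/
theorem corr_partsGenAux (P : Pedigree α π) (c : α) {rec' : α → Gen (Lab α π)}
    {rec : α → PGen (Pt d × Finset (Pt d))}
    (hrec : ∀ c' r, Part.old c' r ∈ P.parts c → Corr Prod.fst (payOfTag cellP) (rec' c') (rec c'))
    (hS : ∀ c', Part.old c' true ∈ P.parts c → P.step c' + 1 = P.step c) :
    ∀ (i : ℕ) (ps : List (Part α π)), (∀ q ∈ ps, q ∈ P.parts c) →
      List.Forall₂ (Corr Prod.fst (payOfTag cellP)) (P.partsGenAux c rec' i ps) (ps.map (P.partPGen cellP c rec))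
  | _, [], _ => by simp [Pedigree.partsGenAux]
  | i, q :: ps, hsub => by
      rw [Pedigree.partsGenAux_cons, List.map_cons, List.forall₂_cons]
      refine ⟨?_, corr_partsGenAux P c hrec hS (i + 1) ps fun q' hq' => hsub q' (List.mem_cons_of_mem _ hq')⟩
      have hq := hsub q List.mem_cons_self
      rcases q with ⟨c', _ | _⟩ | ⟨dd, x⟩
      · exact hrec c' false hq
      · show Corr Prod.fst (payOfTag cellP) (Gen.renew (rec' c') _ (P.step c')) (PGen.renew (rec c') (P.step c'))
        exact ⟨rfl, by rw [← hS c' hq], hrec c' true hq⟩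
      · show Corr Prod.fst (payOfTag cellP) (Gen.born _ (P.step c)) (PGen.birth (P.step c) dd (cellP x))
        exact ⟨rfl, rfl, rfl⟩

/-- **LEAF-09's TAGGED GENEALOGY CORRESPONDS TO ITS CENSUS HISTORY, WITH PAYLOADS**: for a pedigree whose renewed
parts come from the previous step, `Corr Prod.fst (payOfTag cellP) (P.genT c) (P.toPGen cellP c)` for every component
`c` (well-founded recursion on the step, as leaf-09's `toGen_toPGen`). [folklore] -/
theorem corr_genT_toPGen (P : Pedigree α π) (hS : ∀ c c', Part.old c' true ∈ P.parts c → P.step c' + 1 = P.step c)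
    (c : α) : Corr Prod.fst (payOfTag cellP) (P.genT c) (P.toPGen cellP c) := by
  rw [Pedigree.toPGen_eq, Pedigree.genT_eq]
  unfold Pedigree.partsGen
  have key := corr_partsGenAux cellP P c (rec' := P.genT) (rec := P.toPGen cellP)
    (fun c' r hm => by
      have hlt := P.step_lt c c' r hm
      exact corr_genT_toPGen P hS c')
    (hS c) 0 (P.parts c) fun q hq => hq
  cases hps : P.parts c with
  | nil =>
      show Corr Prod.fst (payOfTag cellP) (Gen.born _ (P.step c)) (PGen.birth (P.step c) 0 default)
      exact ⟨rfl, rfl, rfl⟩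
  | cons p ps =>
      rw [hps] at key
      rw [Pedigree.partsGenAux_cons, List.map_cons, List.forall₂_cons] at key
      show Corr Prod.fst (payOfTag cellP) (chainMerge _ _ (P.merLab c)) (chainJoin _ _ (P.step c))
      exact corr_chain cellP (P.step c) _ _ _ _ _ key.1 key.2 fun i => rfl
termination_by P.step c
decreasing_by exact hlt

/-! ## §2 The END-facing corollaries for one realised pending component -/

section Component

variable {ι : Type*} [DecidableEq α] [DecidableEq π]
variable {L : ℕ} (hL : 3 ≤ L) {n : ℕ} (hn : 0 < n) {s : ℕ → ℕ} (hs : ∀ t, s (t + 1) ≤ s t)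
  (hdrop : ∀ m, DropCtl s m) {R : ℕ → ℕ} {K : ℕ}
include hL hn hs hdrop

/-- **THE LEVELLED BIRTH-REGION LAWS FOR A REALISED COMPONENT OF A PEDIGREE** (`Cb = 4·2^d`, collar `32`,
`lv := levelOf s K`): from `Realises L s R (P.toPGen cellP c) Z`, `(P.toPGen cellP c).lastStep ≤ K` and the encoding
fact `renew_step`. [folklore] -/
theorem birthRegionsD_genT (P : Pedigree α π) (hS : ∀ c c', Part.old c' true ∈ P.parts c → P.step c' + 1 = P.step c)
    (c : α) {Z : Finset (Pt d)} (hR : Realises L s R (P.toPGen cellP c) Z) (hK : (P.toPGen cellP c).lastStep ≤ K) :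
    BirthRegionsD Prod.fst n L K (levelOf s K) (4 * 2 ^ d) 32 (P.genT c)
      (regR Prod.fst (payOfTag cellP) n L K (levelOf s K)) :=
  birthRegionsD_of_corr hL hn hs hdrop (corr_genT_toPGen cellP P hS c) hR hK

open scoped Classical

/-- **THE REALISED PLACEMENT OF A REALISED COMPONENT IS ZONE-ADMISSIBLE AT LEVELS** (over a finite-alphabet copy `G′`
of `P.genT c`; chronology displayed — leaf-09's `chronoC_genT` supplies it). [folklore] -/
theorem admZ_genT_of_realises (P : Pedigree α π)
    (hS : ∀ c c', Part.old c' true ∈ P.parts c → P.step c' + 1 = P.step c) (c : α) {Z : Finset (Pt d)}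
    (hR : Realises L s R (P.toPGen cellP c) Z) (hK : (P.toPGen cellP c).lastStep ≤ K) {ϑ : ℝ} (hϑ : 0 < ϑ)
    (hϑ1 : ϑ ≤ 1) (hchr : Chrono (PEv.step ∘ Prod.fst) (P.genT c)) {E : Finset (Lab α π)} {G' : Gen ↥E}
    (hGG : gmap Subtype.val G' = P.genT c) (hN : 0 < n * L ^ K) :
    AdmZ (nearD n L K (levelOf s K) (theta (levelOf s K) ϑ))
      (fun t W => extD Prod.fst n L K (levelOf s K) ϑ (P.genT c)
        (regZoneD Prod.fst n L K (levelOf s K) 32 (regR Prod.fst (payOfTag cellP) n L K (levelOf s K))) t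
        (gmap Subtype.val W))
      ((PEv.step ∘ Prod.fst) ∘ Subtype.val) G'
      (fun b => placeD Prod.fst (payOfTag cellP) n L K hN (levelOf s K) b.1) :=
  admZ_of_corr_realises hL hn hs hdrop (corr_genT_toPGen cellP P hS c) hR hK hϑ hϑ1 hchr hGG hN

/-- **THE (GM) MULTIPLICITY OF A REALISED COMPONENT, WITH WINDOW-DROP STEPS** (row S6's shape, `Kz ↦ σ^{−2d}·Kz`;
well-formedness, chronology and non-kind-`0` merger shapes of `P.genT c` displayed — leaf-09's `wf_genT`,
`chronoC_genT`, and the merger labels `(s, 2, 0)`). [folklore] -/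
theorem card_admZSet_genT_le_of_realises (W : Lab α π → ℕ) (P : Pedigree α π)
    (hS : ∀ c c', Part.old c' true ∈ P.parts c → P.step c' + 1 = P.step c) (c : α) {Z : Finset (Pt d)}
    (hR : Realises L s R (P.toPGen cellP c) Z) (hK : (P.toPGen cellP c).lastStep ≤ K) {σ : ℝ} (h0 : 0 < σ)
    (h1 : σ < 1) (hσL : 1 ≤ (L : ℝ) * σ ^ 4) (hW : (P.genT c).WF W) (hchr : Chrono (PEv.step ∘ Prod.fst) (P.genT c))
    (hk2 : ∀ m ∈ merges (P.genT c), (Prod.fst m : PEv).kind ≠ 0) (E : Finset (Lab α π))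
    (hE : (P.genT c).events ⊆ E) (z c₀' : TCell d (n * L ^ K)) :
    ((admZSet (nearD n L K (levelOf s K) (theta (levelOf s K) (σ ^ 2)))
        (fun t W => extD Prod.fst n L K (levelOf s K) (σ ^ 2) (P.genT c)
          (regZoneD Prod.fst n L K (levelOf s K) 32 (regR Prod.fst (payOfTag cellP) n L K (levelOf s K))) t
          (gmap Subtype.val W))
        ((PEv.step ∘ Prod.fst) ∘ Subtype.val) (grestrict E (P.genT c) hE) (grestrict E (P.genT c) hE).root z c₀').card
        : ℝ) ≤
      ((2 : ℝ) ^ d * (σ ^ 2)⁻¹ ^ d *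
          (max ((4 : ℝ) * 2 ^ d + 2 * (32 : ℕ)) ((2 * (32 : ℕ) + 1) / (1 - σ ^ 2) + 1) +
            2 * ((2 * (32 : ℕ) + 1) / (1 - σ ^ 2)) + 1) ^ d) ^ (merges (P.genT c)).card *
        (∏ e ∈ merges (P.genT c), Q (wcntS Prod.fst (P.genT c)) σ (Prod.fst e : PEv).step ^ (d : ℝ)) *
          ((L : ℝ) ^ d) ^ partnerAges (PEv.step ∘ Prod.fst) (P.genT c) :=
  card_admZSet_le_of_corr_realises hL hn hs hdrop W (corr_genT_toPGen cellP P hS c) hR hK h0 h1 hσL hW hchr hk2 E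
    hE z c₀'

end Component

/-! ## §3 Sanity (decided) -/

namespace SanityZOPed

/-- the payload of a birth tag is read through `cellP`; a merger tag carries the junk value -/
example (cellP : ℕ → Pt 1 × Finset (Pt 1)) :
    payOfTag (α := ℕ) cellP (((0, 0, 1) : PEv), Tag.birth 3 0 1 7) = cellP 7 ∧
      payOfTag (α := ℕ) cellP (((1, 2, 0) : PEv), Tag.mer 3 0) = default := ⟨rfl, rfl⟩

end SanityZOPed

end

end Summit.QuantumFields.BalabanUV.T4Continuum.HistoryZones
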